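import Summits.Ventures.PercRepro.RLSRuleLineFreeSupply

/-!
# PercRepro — traces of a witness inside a SIMPLE plane, the generic assembly, and the triples (night-3, gen 3)

Tools for the `t = 0, P₂` half of the lane on planes WITH a `3`-point line (`proofs/N3-R3PLUS-plan.md` §1):

* `SimpleOn`: two distinct points of `G` have rank `2`;
* `hasLongLine_of_union`: on a simple plane `G`, a `4`-point subset of rank `≤ 2` inside a trace of `B′ ∪ X`
  (`X` independent, off `G`) lies inside `B′` — long lines of traces are long lines of `B′`;
* `card_inter_union_le`: a plane meets `B′ ∪ X` in at most `|G' ∩ B′| + 3` points;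
* **`supply_ge_of_family`**: the generic assembly — per-`(B′, X)` share bounds `f B′ X ≤ w⁺(G, B′ ∪ X)` over a family
  `𝔅` of rank-`3` subsets of `G` and the witness family of an independent `K ⊆ E ∖ G` add up to a lower bound of the
  supply (the witnesses `B′ ∪ X` are distinct members of the middle level);
* `mstar_union_eq_zero_of_triple`, `wPlus_union_ge_of_triple`: every independent triple `T` of a simple plane `G`
  receives at least `1 / C(3 + |X|, 3)` in `T ∪ X` (the Theorem-25 argument inside a bigger plane: a plane `G' ≠ G`
  meets `T ∪ X` in `≤ 2 + 3` points and no trace has a long line);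
* `card_filter_subset_powersetCard` (the `x`-subsets of `K` through a fixed triple number `C(|K| − 3, x − 3)`),
  `exists_indep_compl_card` (an independent `p`-subset of `E ∖ G` when `ρ(E ∖ G) ≥ p`).
Imports `RLSRuleLineFreeSupply`.  Axioms: standard.
-/

open scoped Matroid

namespace PercRepro

namespace NightThree

open Finset ThmH PerFlat

variable {α : Type*} [DecidableEq α] {M : Matroid α} [M.Finite]

/-- Simplicity on a finset: two distinct points have rank `2`. -/
def SimpleOn (M : Matroid α) (G : Finset α) : Prop :=
  ∀ u ∈ G, ∀ v ∈ G, u ≠ v → M.eRk ({u, v} : Set α) = 2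

/-! ### Traces of a witness inside a simple plane -/

/-- On a simple plane `G`, a `4`-point subset of rank `≤ 2` inside a trace of `B′ ∪ X` (`X` independent, off `G`) lies
inside `B′`: long lines of traces are long lines of `B′`. -/
theorem hasLongLine_of_union {G B X F : Finset α} (hG : G ∈ flatsQ M 3) (hsimple : SimpleOn M G)
    (hB : B ⊆ G) (hX : M.Indep (X : Set α)) (hXG : Disjoint X G) (hF : F ⊆ B ∪ X)
    (h : HasLongLine M F) : HasLongLine M B := by
  obtain ⟨L, hL, hr⟩ := h
  rw [Finset.mem_powersetCard] at hL
  obtain ⟨hLF, hLc⟩ := hL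
  have hLBX : L ⊆ B ∪ X := hLF.trans hF
  have hGE : (G : Set α) ⊆ M.E := by rw [← coe_gr M]; exact Finset.coe_subset.2 (mem_flatsQ.1 hG).1
  have hLE : (L : Set α) ⊆ M.E := by
    refine (Finset.coe_subset.2 hLBX).trans ?_
    rw [Finset.coe_union]
    exact Set.union_subset ((Finset.coe_subset.2 hB).trans hGE) hX.subset_ground
  have hLX : (L ∩ X).card ≤ 2 := by
    have hind : M.Indep ((L ∩ X : Finset α) : Set α) :=
      hX.subset (Finset.coe_subset.2 Finset.inter_subset_right)
    have h2 : M.eRk ((L ∩ X : Finset α) : Set α) ≤ 2 :=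
      (M.eRk_mono (Finset.coe_subset.2 Finset.inter_subset_left)).trans hr
    rw [eRk_eq_card_of_indep hind] at h2
    exact_mod_cast h2
  have hLB : 2 ≤ (L ∩ B).card := by
    have hsplit : L = (L ∩ B) ∪ (L ∩ X) := by
      rw [← Finset.inter_union_distrib_left, Finset.inter_eq_left.2 hLBX]
    have hc := Finset.card_union_le (L ∩ B) (L ∩ X)
    rw [← hsplit, hLc] at hc
    omega
  obtain ⟨P, hPsub, hPc⟩ := Finset.exists_subset_card_eq hLB
  have hPB : P ⊆ B := hPsub.trans Finset.inter_subset_right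
  have hPL : P ⊆ L := hPsub.trans Finset.inter_subset_left
  obtain ⟨u, v, huv, rfl⟩ := Finset.card_eq_two.1 hPc
  have hPr : M.eRk (({u, v} : Finset α) : Set α) = 2 := by
    rw [Finset.coe_pair]
    exact hsimple u (hB (hPB (by simp))) v (hB (hPB (by simp))) huv
  have hcl : M.closure (({u, v} : Finset α) : Set α) = M.closure (L : Set α) := by
    apply closure_eq_of_subset_flat (M.isFlat_closure _)
      ((Finset.coe_subset.2 hPL).trans (M.subset_closure _ hLE)) (Finset.finite_toSet _)
    rw [M.eRk_closure_eq, hPr]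
    exact hr
  have hGflat : M.IsFlat (G : Set α) := (mem_flatsQ.1 hG).2.1
  have hLG : L ⊆ G := by
    rw [← Finset.coe_subset]
    calc (L : Set α) ⊆ M.closure (L : Set α) := M.subset_closure _ hLE
      _ = M.closure (({u, v} : Finset α) : Set α) := hcl.symm
      _ ⊆ M.closure (G : Set α) := M.closure_subset_closure (Finset.coe_subset.2 (hPB.trans hB))
      _ = (G : Set α) := hGflat.closure
  have hLB' : L ⊆ B := by
    intro x hx
    have hxG := hLG hx
    rcases Finset.mem_union.1 (hLBX hx) with hxB | hxX
    · exact hxB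
    · exact absurd hxG (Finset.disjoint_left.1 hXG hxX)
  exact ⟨L, Finset.mem_powersetCard.2 ⟨hLB', hLc⟩, hr⟩

/-- A plane `G' ≠ G` meets `B′ ∪ X` in at most `|G' ∩ B′| + 3` points (`X` independent). -/
theorem card_inter_union_le {G' B X : Finset α} (hG' : G' ∈ flatsQ M 3) (hX : M.Indep (X : Set α)) :
    (G' ∩ (B ∪ X)).card ≤ (G' ∩ B).card + 3 := by
  have h2 : (G' ∩ X).card ≤ 3 := by
    have hind : M.Indep ((G' ∩ X : Finset α) : Set α) :=
      hX.subset (Finset.coe_subset.2 Finset.inter_subset_right)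
    have h2' : M.eRk ((G' ∩ X : Finset α) : Set α) ≤ 3 := by
      rw [← eRk_eq_three_of_mem_flatsQ' hG']
      exact M.eRk_mono (Finset.coe_subset.2 Finset.inter_subset_left)
    rw [eRk_eq_card_of_indep hind] at h2'
    exact_mod_cast h2'
  calc (G' ∩ (B ∪ X)).card = ((G' ∩ B) ∪ (G' ∩ X)).card := by rw [Finset.inter_union_distrib_left]
    _ ≤ (G' ∩ B).card + (G' ∩ X).card := Finset.card_union_le _ _
    _ ≤ (G' ∩ B).card + 3 := by omega

/-! ### The generic assembly -/

/-- **Assembly.**  Per-`(B′, X)` lower bounds `f B′ X ≤ w⁺(G, B′ ∪ X)` over a family `𝔅` of rank-`3` subsets of `G`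
and the witness family of an independent `K ⊆ E ∖ G` add up to a lower bound of the supply at `(n + 4, 3)`. -/
theorem supply_ge_of_family {G K : Finset α} (hG : G ∈ flatsQ M 3) {𝔅 : Finset (Finset α)}
    (h𝔅 : ∀ B ∈ 𝔅, B ⊆ G ∧ M.eRk (B : Set α) = 3) (hKsub : K ⊆ gr M \ G) (hKind : M.Indep (K : Set α))
    (n : ℕ) (f : Finset α → Finset α → ℚ)
    (hf : ∀ B ∈ 𝔅, ∀ X ∈ witnessFamily K n, f B X ≤ wPlus M G (B ∪ X)) :
    ∑ B ∈ 𝔅, ∑ X ∈ witnessFamily K n, f B X ≤ ∑ S ∈ Yq M (n + 4) 3, wPlus M G S := by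
  classical
  have hKG : Disjoint K G := by
    rw [Finset.disjoint_left]
    intro x hxK hxG
    have := hKsub hxK
    rw [Finset.mem_sdiff] at this
    exact this.2 hxG
  have himg : (𝔅 ×ˢ witnessFamily K n).image (fun q => q.1 ∪ q.2) ⊆ Yq M (n + 4) 3 := by
    intro S hS
    rw [Finset.mem_image] at hS
    obtain ⟨⟨B, X⟩, hq, rfl⟩ := hS
    rw [Finset.mem_product] at hq
    obtain ⟨hBG, hB3⟩ := h𝔅 B hq.1
    obtain ⟨hXK, h1, h2⟩ := mem_witnessFamily hq.2
    exact union_mem_Yq_of_subset hG hBG hB3 (hKind.subset (Finset.coe_subset.2 hXK))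
      (Finset.disjoint_of_subset_left hXK hKG) h1 (by omega)
  have hinj : Set.InjOn (fun q : Finset α × Finset α => q.1 ∪ q.2)
      ((𝔅 ×ˢ witnessFamily K n : Finset (Finset α × Finset α)) : Set (Finset α × Finset α)) := by
    intro q hq q' hq' h
    obtain ⟨B, X⟩ := q
    obtain ⟨B', X'⟩ := q'
    rw [Finset.mem_coe, Finset.mem_product] at hq hq'
    have hBG := (h𝔅 B hq.1).1
    have hBG' := (h𝔅 B' hq'.1).1
    have hXG : Disjoint X G := Finset.disjoint_of_subset_left (mem_witnessFamily hq.2).1 hKG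
    have hXG' : Disjoint X' G := Finset.disjoint_of_subset_left (mem_witnessFamily hq'.2).1 hKG
    have h' : B ∪ X = B' ∪ X' := h
    have e1 : G ∩ (B ∪ X) = G ∩ (B' ∪ X') := by rw [h']
    rw [inter_union_eq_of_disjoint hBG hXG, inter_union_eq_of_disjoint hBG' hXG'] at e1
    have e2 : (B ∪ X) \ B = (B' ∪ X') \ B' := by rw [h', e1]
    rw [Finset.union_sdiff_cancel_left (Finset.disjoint_of_subset_right hBG hXG).symm,
      Finset.union_sdiff_cancel_left (Finset.disjoint_of_subset_right hBG' hXG').symm] at e2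
    rw [e1, e2]
  calc ∑ B ∈ 𝔅, ∑ X ∈ witnessFamily K n, f B X
      = ∑ q ∈ 𝔅 ×ˢ witnessFamily K n, f q.1 q.2 := by rw [Finset.sum_product]
    _ ≤ ∑ q ∈ 𝔅 ×ˢ witnessFamily K n, wPlus M G (q.1 ∪ q.2) := by
        apply Finset.sum_le_sum
        intro q hq
        obtain ⟨B, X⟩ := q
        rw [Finset.mem_product] at hq
        exact hf B hq.1 X hq.2
    _ = ∑ S ∈ (𝔅 ×ˢ witnessFamily K n).image (fun q => q.1 ∪ q.2), wPlus M G S :=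
        (Finset.sum_image hinj).symm
    _ ≤ ∑ S ∈ Yq M (n + 4) 3, wPlus M G S :=
        Finset.sum_le_sum_of_subset_of_nonneg himg (fun S _ _ => wPlus_nonneg M G S)

/-! ### The independent triples of a simple plane -/

/-- Every trace of `T ∪ X` (`T ⊆ G` an independent triple, `X` independent off the simple plane `G`) is in `𝒯₀`. -/
theorem mstar_union_eq_zero_of_triple {G T X : Finset α} (hG : G ∈ flatsQ M 3) (hsimple : SimpleOn M G)
    (hT : T ⊆ G) (hTind : M.Indep (T : Set α)) (hTc : T.card = 3) (hX : M.Indep (X : Set α))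
    (hXG : Disjoint X G) : mstar M (T ∪ X) = 0 := by
  rw [mstar_eq_zero_iff]
  intro G' hG' hn
  obtain ⟨_, hbig⟩ := hn
  rcases hbig with h6 | hline
  · by_cases hGG : G' = G
    · rw [hGG, inter_union_eq_of_disjoint hT hXG] at h6
      omega
    · have h1 : (G' ∩ T).card ≤ 2 := by
        by_contra h
        push Not at h
        have hTG' : T ⊆ G' := by
          have heq : G' ∩ T = T :=
            Finset.eq_of_subset_of_card_le Finset.inter_subset_right (by omega)
          rw [← heq]
          exact Finset.inter_subset_left
        have hT3 : M.eRk (T : Set α) = 3 := eRk_eq_three_of_indep_card hTind hTc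
        rw [flatsQ_three] at hG hG'
        exact hGG (planes_eq_of_subset hG' hG hTG' hT hT3)
      have := card_inter_union_le (B := T) (X := X) hG' hX
      omega
  · have hlong := hasLongLine_of_union hG hsimple hT hX hXG Finset.inter_subset_right hline
    obtain ⟨L, hL, _⟩ := hlong
    rw [Finset.mem_powersetCard] at hL
    have := Finset.card_le_card hL.1
    omega

/-- An independent triple `T` of a simple plane `G` gives `G` at least `1 / C(3 + |X|, 3)` in `T ∪ X`. -/
theorem wPlus_union_ge_of_triple {G T X : Finset α} (hG : G ∈ flatsQ M 3) (hsimple : SimpleOn M G)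
    (hT : T ⊆ G) (hTind : M.Indep (T : Set α)) (hTc : T.card = 3) (hX : M.Indep (X : Set α))
    (hXG : Disjoint X G) : 1 / (((3 + X.card).choose 3 : ℕ) : ℚ) ≤ wPlus M G (T ∪ X) := by
  have hS : T ∪ X ⊆ gr M := by
    apply Finset.union_subset (hT.trans (mem_flatsQ.1 hG).1)
    rw [← Finset.coe_subset, coe_gr]
    exact hX.subset_ground
  have h := wPlus_ge_of_mstar_zero hS (mstar_union_eq_zero_of_triple hG hsimple hT hTind hTc hX hXG) G
  rw [inter_union_eq_of_disjoint hT hXG, rho3_eq_one_of_indep_card_three hTind hTc,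
    Finset.card_union_of_disjoint (Finset.disjoint_of_subset_right hT hXG).symm, hTc, Nat.cast_one] at h
  exact h

/-! ### Two counting tools -/

/-- The `x`-subsets of `K` containing a fixed `3`-subset `C` number `C(|K| − 3, x − 3)` (`x ≥ 3`). -/
theorem card_filter_subset_powersetCard {K C : Finset α} (hC : C ⊆ K) (hCc : C.card = 3) {x : ℕ} (hx : 3 ≤ x) :
    ((K.powersetCard x).filter (fun X => C ⊆ X)).card = (K.card - 3).choose (x - 3) := by
  classical
  rw [← hCc, ← Finset.card_sdiff_of_subset hC, ← Finset.card_powersetCard]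
  symm
  apply Finset.card_bij (fun Y _ => Y ∪ C)
  · intro Y hY
    rw [Finset.mem_powersetCard] at hY
    rw [Finset.mem_filter, Finset.mem_powersetCard]
    refine ⟨⟨Finset.union_subset (hY.1.trans Finset.sdiff_subset) hC, ?_⟩, Finset.subset_union_right⟩
    rw [Finset.card_union_of_disjoint (Finset.disjoint_of_subset_left hY.1 Finset.sdiff_disjoint), hY.2]
    omega
  · intro Y hY Y' hY' h
    rw [Finset.mem_powersetCard] at hY hY'
    have h1 : (Y ∪ C) \ C = Y :=
      Finset.union_sdiff_cancel_right (Finset.disjoint_of_subset_left hY.1 Finset.sdiff_disjoint)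
    have h2 : (Y' ∪ C) \ C = Y' :=
      Finset.union_sdiff_cancel_right (Finset.disjoint_of_subset_left hY'.1 Finset.sdiff_disjoint)
    rw [← h1, ← h2, h]
  · intro X hX
    rw [Finset.mem_filter, Finset.mem_powersetCard] at hX
    refine ⟨X \ C, ?_, ?_⟩
    · rw [Finset.mem_powersetCard]
      refine ⟨Finset.sdiff_subset_sdiff hX.1.1 le_rfl, ?_⟩
      rw [Finset.card_sdiff_of_subset hX.2, hX.1.2]
    · exact Finset.sdiff_union_of_subset hX.2

/-- An independent `(n + 4)`-subset of `E ∖ G` when `ρ(E ∖ G) ≥ n + 4`. -/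
theorem exists_indep_compl_card (G : Finset α) {p : ℕ}
    (hK : (p : ℕ∞) ≤ M.eRk ((gr M \ G : Finset α) : Set α)) :
    ∃ K : Finset α, K ⊆ gr M \ G ∧ M.Indep (K : Set α) ∧ K.card = p := by
  have hsubE : ((gr M \ G : Finset α) : Set α) ⊆ M.E := by
    rw [← coe_gr M]
    exact Finset.coe_subset.2 Finset.sdiff_subset
  obtain ⟨I, hI⟩ := M.exists_isBasis _ hsubE
  have hIfin : I.Finite := (gr M \ G).finite_toSet.subset hI.subset
  have hIcard : p ≤ hIfin.toFinset.card := by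
    have h1 := hI.encard_eq_eRk
    rw [← hIfin.coe_toFinset, Set.encard_coe_eq_coe_finsetCard] at h1
    rw [← h1] at hK
    exact_mod_cast hK
  obtain ⟨K, hKI, hKcard⟩ := Finset.exists_subset_card_eq hIcard
  have hKsub : (K : Set α) ⊆ I := by
    rw [← hIfin.coe_toFinset]
    exact Finset.coe_subset.2 hKI
  refine ⟨K, ?_, hI.indep.subset hKsub, hKcard⟩
  rw [← Finset.coe_subset]
  exact hKsub.trans hI.subset

end NightThree

end PercRepro
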